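import Mathlib.Analysis.Complex.CauchyIntegral
import Literature.NumberTheory.LFunctions.XiDerivativeZerosStrip
import Summits.RiemannHypothesis.RiemannHypothesis.Theorems.JensenLogBandArcTransform
import Summits.RiemannHypothesis.RiemannHypothesis.Theorems.JensenLogBandArcRadius
import Summits.RiemannHypothesis.RiemannHypothesis.Theorems.JensenLogBandBandOfShell
import Summits.RiemannHypothesis.RiemannHypothesis.Theorems.JensenLogBandXiDerivEdgeRealCounting
import Summits.RiemannHypothesis.RiemannHypothesis.Theorems.JensenLogBandShellFar
import Summits.RiemannHypothesis.RiemannHypothesis.Theorems.JensenLogBandShellNear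
import Summits.RiemannHypothesis.RiemannHypothesis.Theses.JensenLogBand
import HarnessLib

/-!
# BAND crux `XiDerivBandRealAllRates` of route JensenLogBand — the closing composition (RH-FREE)

RH ladder column JENSEN, rung J-P(P3) «log band», BAND crux `XiDerivBandRealAllRates`
(stmt-RiemannHypothesis-19913), line «band-one-window» (u-arc, TOP-SHELL reshape), lead
rh-jensen-prover g8 (successor of g7; analytic inputs by eng-2 g6/g7, theory g11/g12, idea-2 g7/g8).
WHAT THIS IS NOT: nothing here bears on zeros of `ζ` off the line or the truth of RH; the binder
`c < 8` excludes the quasi-RH instances.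

This is the registered skeleton (`ledger skeleton check`, crux workitem evidence #19/#20) with its
two stubs now LANDED theorems: `UArc.stub_shellNear` (`Theorems/JensenLogBandShellNear`) and
`UArc.stub_shellFar` (`Theorems/JensenLogBandShellFar`). By the tree reduction «BAND ⇐ TOP SHELL»
(`LogBand.BandOfShell.allReal_below_exp_of_shellReal`) the band at rate `c' < 8` follows from
realness of the zeros of `ξ₁⁽ᵏ⁾` in the TOP SHELLS `e^{c(k−1)}/4 ≤ ‖z‖ < e^{ck}` at the one rate
`c = (max c' 7 + 8)/2 ∈ [7.5, 8)`; there, a non-real zero `z = v²`, `v = a + iT`, `0 < a ≤ ½`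
(Gauss–Lucas localisation), is excluded by the split at the admissible radius `h(k,T)` and the
dominance `‖U_{k,h}(−a+iT)‖ < ‖U_{k,h}(a+iT)‖` (near zone `a ≤ 2/c − ¼`, far zone `a > 2/c − ¼`).
-/

set_option linter.dupNamespace false

noncomputable section

open Complex Real
open scoped ComplexConjugate

namespace Summit.RiemannHypothesis.RiemannHypothesis.Cruxes.XiDerivBandRealAllRates.UArc

open Literature.NumberTheory.LFunctions
open Summit.RiemannHypothesis.RiemannHypothesis.Theorems.JensenPolynomials.LogBandArc
open Summit.RiemannHypothesis.RiemannHypothesis.Theorems.JensenPolynomials.LogBand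

/-! ## §2 Proved plumbing used by the composition (RH-FREE) -/

/-- A square root with positive real and imaginary parts of a point of the upper half-plane
(rh-jensen-idea-1 g3, verbatim): `Im w > 0 ⇒ ∃ u, u² = w ∧ Re u > 0 ∧ Im u > 0`. [folklore] -/
theorem exists_sq_eq_of_im_pos {w : ℂ} (hw : 0 < w.im) :
    ∃ u : ℂ, u ^ 2 = w ∧ 0 < u.re ∧ 0 < u.im := by
  have hnorm : ‖w‖ ^ 2 = w.re ^ 2 + w.im ^ 2 := by
    rw [Complex.sq_norm, Complex.normSq_apply]; ring
  have habs : |w.re| < ‖w‖ := by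
    by_contra hcon
    push Not at hcon
    have h1 := mul_self_le_mul_self (norm_nonneg w) hcon
    nlinarith [abs_mul_abs_self w.re]
  have hApos : 0 < (‖w‖ + w.re) / 2 := by
    have := neg_abs_le w.re
    linarith
  have hBpos : 0 < (‖w‖ - w.re) / 2 := by
    have := le_abs_self w.re
    linarith
  set A := Real.sqrt ((‖w‖ + w.re) / 2) with hA
  set B := Real.sqrt ((‖w‖ - w.re) / 2) with hB
  have hA2 : A ^ 2 = (‖w‖ + w.re) / 2 := Real.sq_sqrt hApos.le
  have hB2 : B ^ 2 = (‖w‖ - w.re) / 2 := Real.sq_sqrt hBpos.le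
  have hA0 : 0 < A := Real.sqrt_pos.mpr hApos
  have hB0 : 0 < B := Real.sqrt_pos.mpr hBpos
  have hABsq : (A * B) ^ 2 = (w.im / 2) ^ 2 := by
    rw [mul_pow, hA2, hB2]
    linear_combination (1 / 4 : ℝ) * hnorm
  have hAB : A * B = w.im / 2 := by
    have h0 : 0 < A * B := mul_pos hA0 hB0
    nlinarith [hABsq, h0, hw, sq_nonneg (A * B - w.im / 2), sq_nonneg (A * B + w.im / 2)]
  refine ⟨⟨A, B⟩, ?_, hA0, hB0⟩
  apply Complex.ext
  · simp [sq, Complex.mul_re]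
    nlinarith [hA2, hB2]
  · simp [sq, Complex.mul_im]
    linarith [hAB]

/-- `2.718281828 < e`, so `256 ≤ e⁶` and `e < 3` (numerics for the shell/band comparison).
[folklore] -/
theorem exp_six_ge_256 : (256 : ℝ) ≤ Real.exp 6 := by
  have h1 : (2.7182818283 : ℝ) < Real.exp 1 := Real.exp_one_gt_d9
  have h6 : Real.exp 6 = Real.exp 1 ^ 6 := by
    rw [← Real.exp_nat_mul]; norm_num
  rw [h6]
  have h0 : (0 : ℝ) ≤ 2.7182818283 := by norm_num
  have := pow_le_pow_left₀ h0 h1.le 6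
  nlinarith [this]

/-- **The top shell lies above the band's lower edge**: for `c ≥ 7` and `k ≥ 3`,
`64 (k/log k)² ≤ e^{c(k−1)}/4`. (`log k ≥ 1`, `k ≤ e^{k−1}`, `256 ≤ e⁶`, `2(k−1)+6 ≤ 7(k−1)`.)
[folklore] -/
theorem band_lower_le_shell_lower {c : ℝ} (hc : 7 ≤ c) {k : ℕ} (hk : 3 ≤ k) :
    64 * ((k : ℝ) / Real.log k) ^ 2 ≤ Real.exp (c * ((k : ℝ) - 1)) / 4 := by
  have hk3 : (3 : ℝ) ≤ k := by exact_mod_cast hk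
  have hk0 : (0 : ℝ) < k := by linarith
  -- `log k ≥ 1`
  have hlog1 : 1 ≤ Real.log k := by
    have he : Real.exp 1 ≤ 3 := by
      have := Real.exp_one_lt_d9; linarith
    calc (1 : ℝ) = Real.log (Real.exp 1) := (Real.log_exp 1).symm
      _ ≤ Real.log 3 := Real.log_le_log (Real.exp_pos 1) he
      _ ≤ Real.log k := Real.log_le_log (by norm_num) hk3
  have hlogpos : 0 < Real.log k := by linarith
  -- `(k / log k)² ≤ k²`
  have hdiv : (k : ℝ) / Real.log k ≤ k := by
    rw [div_le_iff₀ hlogpos]; nlinarith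
  have hdiv0 : 0 ≤ (k : ℝ) / Real.log k := div_nonneg hk0.le hlogpos.le
  have hsq : ((k : ℝ) / Real.log k) ^ 2 ≤ (k : ℝ) ^ 2 := pow_le_pow_left₀ hdiv0 hdiv 2
  -- `k ≤ e^{k-1}`
  have hke : (k : ℝ) ≤ Real.exp ((k : ℝ) - 1) := by
    have := Real.add_one_le_exp ((k : ℝ) - 1); linarith
  have hk2e : (k : ℝ) ^ 2 ≤ Real.exp (2 * ((k : ℝ) - 1)) := by
    have := pow_le_pow_left₀ hk0.le hke 2
    rwa [← Real.exp_nat_mul, show ((2 : ℕ) : ℝ) * ((k : ℝ) - 1) = 2 * ((k : ℝ) - 1) by norm_num]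
      at this
  -- assemble: `256 k² ≤ e⁶ e^{2(k-1)} = e^{2(k-1)+6} ≤ e^{7(k-1)} ≤ e^{c(k-1)}`
  have h1 : 256 * (k : ℝ) ^ 2 ≤ Real.exp (2 * ((k : ℝ) - 1) + 6) := by
    rw [Real.exp_add]
    have := exp_six_ge_256
    nlinarith [Real.exp_pos (2 * ((k : ℝ) - 1)), this, hk2e]
  have h2 : Real.exp (2 * ((k : ℝ) - 1) + 6) ≤ Real.exp (c * ((k : ℝ) - 1)) := by
    apply Real.exp_le_exp.2
    nlinarith
  nlinarith [h1, h2, hsq]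

/-! ## §3 The composition (kernel-checked): near + far ⇒ SHELL ⇒ the crux BY NAME -/

/-- **DOMINANCE ⇒ SHELL (RH-FREE, PROVED).** If at rate `c ∈ [7, 8)` the near and far dominances hold
in the top shell, then for all large `k` every zero of `ξ₁⁽ᵏ⁾` in the top shell
`e^{c(k−1)}/4 ≤ ‖z‖ < e^{ck}` is real: a zero `z` with `Im z > 0` is `v²`, `v = a + iT`,
`0 < a ≤ ½` (critical-strip localisation, tree p478060), `T > 0`; the split at radius `h(k,T)`
(admissible since the shell lies above the band's lower edge) and the dominance give `ξ₁⁽ᵏ⁾(v²) ≠ 0`;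
`Im z < 0` by conjugation. -/
theorem shellReal_of_dominance {c : ℝ} (hc7 : 7 ≤ c) (hc8 : c < 8)
    (hN : ∃ k₁ : ℕ, ∀ k : ℕ, k₁ ≤ k → ∀ a T : ℝ,
      0 < a → a ≤ 2 / c - 1 / 4 → 0 < T →
      Real.exp (c * ((k : ℝ) - 1)) / 4 ≤ ‖((a : ℂ) + (T : ℂ) * I) ^ 2‖ →
      ‖((a : ℂ) + (T : ℂ) * I) ^ 2‖ < Real.exp (c * (k : ℝ)) →
      ‖xiSqArcU k (bandRadius k T) (-(a : ℂ) + (T : ℂ) * I)‖ <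
        ‖xiSqArcU k (bandRadius k T) ((a : ℂ) + (T : ℂ) * I)‖)
    (hF : ∃ k₂ : ℕ, ∀ k : ℕ, k₂ ≤ k → ∀ a T : ℝ,
      2 / c - 1 / 4 < a → a ≤ 1 / 2 → 0 < T →
      Real.exp (c * ((k : ℝ) - 1)) / 4 ≤ ‖((a : ℂ) + (T : ℂ) * I) ^ 2‖ →
      ‖((a : ℂ) + (T : ℂ) * I) ^ 2‖ < Real.exp (c * (k : ℝ)) →
      ‖xiSqArcU k (bandRadius k T) (-(a : ℂ) + (T : ℂ) * I)‖ <
        ‖xiSqArcU k (bandRadius k T) ((a : ℂ) + (T : ℂ) * I)‖) :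
    ∃ k₁ : ℕ, ∀ k : ℕ, k₁ ≤ k → ∀ z : ℂ, iteratedDeriv k xiSq z = 0 →
      Real.exp (c * ((k : ℝ) - 1)) / 4 ≤ ‖z‖ → ‖z‖ < Real.exp (c * (k : ℝ)) → z.im = 0 := by
  have _hc8 := hc8
  obtain ⟨n₀, h0⟩ := bandRadius_admissible
  obtain ⟨n₁, h1⟩ := hN
  obtain ⟨n₂, h2⟩ := hF
  refine ⟨max (max n₀ n₁) (max n₂ 3), ?_⟩
  intro n hn z hz hlo hhi
  have hn₀ : n₀ ≤ n := le_trans (le_trans (le_max_left _ _) (le_max_left _ _)) hn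
  have hn₁ : n₁ ≤ n := le_trans (le_trans (le_max_right _ _) (le_max_left _ _)) hn
  have hn₂ : n₂ ≤ n := le_trans (le_trans (le_max_left _ _) (le_max_right _ _)) hn
  have hn3 : 3 ≤ n := le_trans (le_trans (le_max_right _ _) (le_max_right _ _)) hn
  have hshell := band_lower_le_shell_lower hc7 hn3
  -- the upper-half-plane case
  have key : ∀ w : ℂ, iteratedDeriv n xiSq w = 0 → Real.exp (c * ((n : ℝ) - 1)) / 4 ≤ ‖w‖ →
      ‖w‖ < Real.exp (c * (n : ℝ)) → 0 < w.im → False := by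
    intro w hw hwlo hwhi hwim
    obtain ⟨u, hu2, hure, huim⟩ := exists_sq_eq_of_im_pos hwim
    have hu : u = ((u.re : ℝ) : ℂ) + ((u.im : ℝ) : ℂ) * I := by
      apply Complex.ext <;> simp
    have hw_eq : (((u.re : ℝ) : ℂ) + ((u.im : ℝ) : ℂ) * I) ^ 2 = w := by rw [← hu]; exact hu2
    have hzero : iteratedDeriv n xiSq (u ^ 2) = 0 := by rw [hu2]; exact hw
    -- critical-strip localisation: |Re u| ≤ ½ (tree, Gauss–Lucas in genus 0)
    have hhalf : |u.re| ≤ 1 / 2 :=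
      Literature.NumberTheory.LFunctions.abs_re_le_half_of_iteratedDeriv_xiSq_sq_eq_zero hzero
    have ha_le : u.re ≤ 1 / 2 := (le_abs_self _).trans hhalf
    -- the shell lies above the band's lower edge, so the radius is admissible
    have hwlo' : 64 * ((n : ℝ) / Real.log n) ^ 2 ≤ ‖(((u.re : ℝ) : ℂ) + ((u.im : ℝ) : ℂ) * I) ^ 2‖ := by
      rw [hw_eq]; exact hshell.trans hwlo
    obtain ⟨-, hh0, hh2⟩ := h0 n hn₀ u.re u.im hhalf huim hwlo'
    have hnorm_v : u.im ≤ ‖u‖ := (le_abs_self _).trans (Complex.abs_im_le_norm u)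
    have hh2' : bandRadius n u.im < 2 * ‖u‖ := by linarith
    -- dominance from the near or the far zone
    have hdom : ‖xiSqArcU n (bandRadius n u.im) (-((u.re : ℝ) : ℂ) + ((u.im : ℝ) : ℂ) * I)‖ <
        ‖xiSqArcU n (bandRadius n u.im) (((u.re : ℝ) : ℂ) + ((u.im : ℝ) : ℂ) * I)‖ := by
      rcases le_or_gt u.re (2 / c - 1 / 4) with hle | hgt
      · exact h1 n hn₁ u.re u.im hure hle huim (by rw [hw_eq]; exact hwlo)
          (by rw [hw_eq]; exact hwhi)
      · exact h2 n hn₂ u.re u.im hgt ha_le huim (by rw [hw_eq]; exact hwlo)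
          (by rw [hw_eq]; exact hwhi)
    rw [← neg_conj_ofReal_add_mul_I, ← hu] at hdom
    exact iteratedDeriv_xiSq_sq_ne_zero_of_dominance n hh0 hh2' hdom hzero
  rcases lt_trichotomy z.im 0 with hlt | heq | hgt
  · exfalso
    refine key (conj z) ?_ ?_ ?_ ?_
    · rw [iteratedDeriv_xiSq_conj, hz, map_zero]
    · rwa [Complex.norm_conj]
    · rwa [Complex.norm_conj]
    · rw [Complex.conj_im]; linarith
  · exact heq
  · exfalso; exact key z hz hlo hhi hgt

/-- **SHELL AT RATES `7 ≤ c < 8` ⇒ THE BAND AT EVERY RATE (RH-FREE, PROVED).** Given the near and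
far dominance stubs, the route crux follows: for `c' ∈ (0, 8)` pick `c = (max c' 7 + 8)/2 ∈ [7.5, 8)`,
`c' < c`; `shellReal_of_dominance` gives realness in the top shells at rate `c`, and the tree reduction
`BandOfShell.allReal_below_exp_of_shellReal` (realness ladder + effective Kim–Lee floor) gives
realness of EVERY zero of `ξ₁⁽ⁿ⁾` of modulus `< e^{c'n}` for `n ≥ n₁(c')` — in particular of those
in the band `64(n/log n)² ≤ ‖z‖ < e^{c'n}`. -/
theorem XiDerivBandRealAllRates_of
    (hN : ∀ c : ℝ, 7 ≤ c → c < 8 → ∃ k₁ : ℕ, ∀ k : ℕ, k₁ ≤ k → ∀ a T : ℝ,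
      0 < a → a ≤ 2 / c - 1 / 4 → 0 < T →
      Real.exp (c * ((k : ℝ) - 1)) / 4 ≤ ‖((a : ℂ) + (T : ℂ) * I) ^ 2‖ →
      ‖((a : ℂ) + (T : ℂ) * I) ^ 2‖ < Real.exp (c * (k : ℝ)) →
      ‖xiSqArcU k (bandRadius k T) (-(a : ℂ) + (T : ℂ) * I)‖ <
        ‖xiSqArcU k (bandRadius k T) ((a : ℂ) + (T : ℂ) * I)‖)
    (hF : ∀ c : ℝ, 7 ≤ c → c < 8 → ∃ k₂ : ℕ, ∀ k : ℕ, k₂ ≤ k → ∀ a T : ℝ,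
      2 / c - 1 / 4 < a → a ≤ 1 / 2 → 0 < T →
      Real.exp (c * ((k : ℝ) - 1)) / 4 ≤ ‖((a : ℂ) + (T : ℂ) * I) ^ 2‖ →
      ‖((a : ℂ) + (T : ℂ) * I) ^ 2‖ < Real.exp (c * (k : ℝ)) →
      ‖xiSqArcU k (bandRadius k T) (-(a : ℂ) + (T : ℂ) * I)‖ <
        ‖xiSqArcU k (bandRadius k T) ((a : ℂ) + (T : ℂ) * I)‖) :
    (∀ c : ℝ, 0 < c → c < 8 → ∃ n₁ : ℕ, ∀ n : ℕ, n₁ ≤ n → ∀ z : ℂ,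
      iteratedDeriv n xiSq z = 0 →
      64 * ((n : ℝ) / Real.log n) ^ 2 ≤ ‖z‖ → ‖z‖ < Real.exp (c * (n : ℝ)) → z.im = 0) := by
  intro c' hc'0 hc'8
  set c : ℝ := (max c' 7 + 8) / 2 with hc
  have hm7 : (7 : ℝ) ≤ max c' 7 := le_max_right _ _
  have hm8 : max c' 7 < 8 := max_lt hc'8 (by norm_num)
  have hc7 : 7 ≤ c := by rw [hc]; linarith
  have hc8 : c < 8 := by rw [hc]; linarith
  have hcc : c' < c := by
    have : c' ≤ max c' 7 := le_max_left _ _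
    rw [hc]; linarith
  obtain ⟨k₁, hk₁⟩ := shellReal_of_dominance hc7 hc8 (hN c hc7 hc8) (hF c hc7 hc8)
  obtain ⟨n₁, hn₁⟩ := BandOfShell.allReal_below_exp_of_shellReal hc'0 hcc hk₁
  exact ⟨n₁, fun n hn z hz _ hhi => hn₁ n hn z hz hhi⟩

/-- **THE ROUTE CRUX BY NAME** (kernel-checked composition of the two landed shell theorems
`stub_shellNear` (`Theorems/JensenLogBandShellNear`) and `stub_shellFar` (`Theorems/JensenLogBandShellFar`)):
the registered skeleton's end-to-end statement, complete. RH-FREE. -/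
theorem XiDerivBandRealAllRates_of_stubs : Summit.RiemannHypothesis.RiemannHypothesis.Theses.JensenLogBand.XiDerivBandRealAllRates :=
  fun c hc0 hc8 => XiDerivBandRealAllRates_of stub_shellNear stub_shellFar c hc0 hc8

end Summit.RiemannHypothesis.RiemannHypothesis.Cruxes.XiDerivBandRealAllRates.UArc

namespace Summit.RiemannHypothesis.RiemannHypothesis.Theorems

/-- **BAND crux `XiDerivBandRealAllRates` of route JensenLogBand — PROVED (RH-FREE).** For every rate
`0 < c < 8` there is `n₁(c)` such that for `n ≥ n₁` every zero `z` of `ξ₁⁽ⁿ⁾ = (xiSq)⁽ⁿ⁾` in the band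
`64(n/log n)² ≤ ‖z‖ < e^{cn}` is real. Proof: the u-arc saddle-window dominance in the top shells at
rates `7 ≤ c < 8` (near zone by Cauchy transfer against the translated-saddle model, far zone by the
strip majorant), the admissible-radius split, Gauss–Lucas localisation, and the reduction
«BAND ⇐ TOP SHELL» (`BandOfShell.allReal_below_exp_of_shellReal`). WHAT THIS IS NOT: the binder
`c < 8` keeps this RH-free — nothing here bears on zeros of `ζ` off the line or the truth of RH. -/
theorem XiDerivBandRealAllRates_proof :
    Summit.RiemannHypothesis.RiemannHypothesis.Theses.JensenLogBand.XiDerivBandRealAllRates :=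
  Summit.RiemannHypothesis.RiemannHypothesis.Cruxes.XiDerivBandRealAllRates.UArc.XiDerivBandRealAllRates_of_stubs

end Summit.RiemannHypothesis.RiemannHypothesis.Theorems

end
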